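import Mathlib.NumberTheory.LSeries.RiemannZeta
import Literature.NumberTheory.LFunctions.ZeroGaps
import Literature.NumberTheory.LFunctions.SubnormalZetaGapsLOneLowerBound
import HarnessLib

/-!
# Zeros of `ζ′` close to the critical line force many small gaps between zeros of `ζ`
# (Farmer–Ki 2012, Theorem 1.3) — an exit towards «no Landau–Siegel zero» via Conrey–Iwaniec

Statement layer for the «illusory world» column, direction II (exits `X ⇒ no Siegel zeros`), family
«small gaps between zeros of `ζ` ⇒ effective lower bounds for `L(1, χ)`» (Conrey–Iwaniec 2002, the
tree's `conreyIwaniec2002_theorem12`, `SubnormalZetaGapsLOneLowerBound.lean`): Farmer–Ki push the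
hypothesis one step back, to the horizontal distribution of the zeros of `ζ′`. Source: D. W. Farmer,
H. Ki, *Landau–Siegel zeros and zeros of the derivative of the Riemann zeta function*, Adv. Math. 230
(2012) 2048–2064 [FarmerKi2012]; held copy = arXiv:1002.1616 (tex), §1 (1.1)–(1.6), Theorems 1.1,
1.3, Conjecture 1.2.

## What the source prints (§1)

"We assume the Riemann hypothesis and write the zeros of `ζ` as `ρ_j = ½ + iγ_j` and the zeros of
`ζ′` as `β′_j + iγ′_j`, where in both cases we list the zeros by increasing imaginary part."
(1.1)–(1.3): `λ_j = (γ_{j+1} − γ_j) log γ_j`, `λ′_j = (β′_j − ½) log γ′_j`, `m(ν)`, `m′(ν)`.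
"For applications to lower bounds of class numbers [M, CI] one does not actually need `m(ν) > 0` for
`ν < π`; it is sufficient to show that a relatively small number of gaps between zeros of the zeta
function are small. … Denote `log₍₂₎ t = log log t`.
**Theorem 1.3.** Assume RH. Suppose that for all `ν > 0`,
(1.5) `#{0 < γ′ < T : (β′ − ½) log γ′ ≤ ν} ≥ e^{−C(ν)} T log T   (ν > 0, T → ∞)`,
as `T → ∞`, where `C(ν) > 0` for `ν > 0` with `lim_{ν→0⁺} √ν C(ν) = 0` and `lim_{ν→0⁺} C(ν) = ∞`.
Then (1.6) `liminf_{T→∞} #{γ_n ≤ T : (γ_{n+1} − γ_n) log γ_n ≤ ν} / (T log T/log₍₂₎ T) > 0` for all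
`ν > 0`."
"The conclusion of the theorem is weaker than `m(ν) > 0` for `ν > 0`, but only by a factor of
`log₍₂₎ T`. Thus, it is more than sufficient to apply the results of Conrey and Iwaniec [CI]. In
particular, Theorem 1.3 shows that it is possible to obtain lower bounds for class numbers of
imaginary quadratic fields from knowledge of the density of zeros of the derivative of the Riemann
zeta function."

## Typing notes

* `γ_n` = the tree's `zetaOrdinate n` (ordinates with multiplicity, non-decreasing;
  `ZetaZeros.lean`), so `#{γ_n ≤ T : (γ_{n+1} − γ_n) log γ_n ≤ ν}` counts indices `n`
  (`FarmerKi2012.smallGapCount`); the zeros of `ζ′` in (1.5) are counted as DISTINCT points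
  `ρ′ = β′ + iγ′` with `ζ′(ρ′) = 0`, `0 < γ′ < T`, `(β′ − ½) log γ′ ≤ ν` (`Set.ncard`; counting
  without multiplicity makes the hypothesis harder to satisfy, so the typed theorem is implied by any
  with-multiplicity reading — safe direction).
* "(ν > 0, T → ∞)" is `∀ ν > 0, ∃ T₀, ∀ T ≥ T₀`; `liminf … > 0` is `∃ c > 0, ∃ T₀, ∀ T ≥ T₀,
  count ≥ c · T log T/log log T`; the side conditions on `C(ν)` are `Tendsto` statements at `𝓝[>] 0`.
  RH is Mathlib's `RiemannHypothesis`.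
* S6/vacuity: the hypothesis is RH ∧ (1.5) — a statement about `ζ′`, not about an exceptional
  character; nothing here is voided by Siegel's theorem. The EXIT is completed in print by
  Conrey–Iwaniec's Theorem 1.2 (`conreyIwaniec2002_theorem12`: enough close pairs of zeros ⇒
  `L(1, χ) ≫ (log q)^{−90}` effectively); the kernel link from (1.6) to the tree's
  `SubnormalGapsHypothesis` (which asks the count for EVERY `T ≥ 2001` and close CRITICAL neighbours)
  would need the bridge facts of `ZetaZeros.lean` (`exists_zero_of_zetaOrdinate`, multiplicities) and
  is NOT attempted here — recorded as the source's own remark only.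

## Contents

* `FarmerKi2012.derivZerosNearLine ν T`, `FarmerKi2012.smallGapCount ν T`,
  `FarmerKi2012.Hypothesis15 C` (PRED: (1.5) with its side conditions on `C`);
* `farmerKi2012_theorem13` — NAMED FACT, Theorem 1.3 AS PRINTED;
* PROVED: `FarmerKi2012.smallGapCount_mono` (the count is monotone in `ν`), and the reading
  `FarmerKi2012.many_small_gaps` (RH ∧ (1.5) ⇒ for every `ν > 0` the number of `ν`-small normalised
  gaps `γ_n ≤ T` is `≥ c T log T/log log T` for large `T` — i.e. unbounded, `> T (log T)^{4/5}`
  eventually).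

Index only: Theorem 1.1 (Ki 2008: on RH, `λ′ > 0` ⇔ a lower bound for `M` near the line),
Conjecture 1.2 (`m′(ν) ≫ ν^α`, `α < 2` ⇒ `m(ν) > 0`), §4 examples.

LABEL: instrument / statement layer (exit family II.3). WHAT THIS IS NOT: no claim about the zeros
of `ζ′`; RH is a hypothesis of the printed theorem; nothing here bears on parity.

## References

* [FarmerKi2012] D. W. Farmer, H. Ki, *Landau–Siegel zeros and zeros of the derivative of the
  Riemann zeta function*, Adv. Math. 230 (2012), no. 4-6, 2048–2064, doi:10.1016/j.aim.2012.04.020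
  = arXiv:1002.1616: §1 (1.1)–(1.6), Theorem 1.3 and the paragraph after it.
* [ConreyIwaniec2002] J. B. Conrey, H. Iwaniec, Acta Arith. 103 (2002) 259–312, Theorem 1.2 (the
  tree's `conreyIwaniec2002_theorem12`).
-/

noncomputable section

open Filter Topology Real

namespace Literature.NumberTheory.LFunctions

namespace FarmerKi2012

/-- The zeros `ρ′ = β′ + iγ′` of `ζ′` counted in (1.5): `0 < γ′ < T` and `(β′ − ½) log γ′ ≤ ν`
(as a set of distinct points). [cite: FarmerKi2012, §1 (1.1) and (1.5)] -/
def derivZerosNearLine (ν T : ℝ) : Set ℂ :=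
  {ρ : ℂ | deriv riemannZeta ρ = 0 ∧ 0 < ρ.im ∧ ρ.im < T ∧ (ρ.re - 1 / 2) * Real.log ρ.im ≤ ν}

/-- `#{γ_n ≤ T : (γ_{n+1} − γ_n) log γ_n ≤ ν}` — indices of `ν`-small normalised gaps between
consecutive ordinates (the tree's `zetaOrdinate`, with multiplicity) up to height `T`.
[cite: FarmerKi2012, §1 (1.1) and (1.6)] -/
def smallGapCount (ν T : ℝ) : ℕ :=
  {n : ℕ | zetaOrdinate n ≤ T ∧
    (zetaOrdinate (n + 1) - zetaOrdinate n) * Real.log (zetaOrdinate n) ≤ ν}.ncard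

/-- **Hypothesis (1.5) of Theorem 1.3** with its side conditions on `C`: `C(ν) > 0` for `ν > 0`,
`√ν C(ν) → 0` and `C(ν) → ∞` as `ν → 0⁺`, and for every `ν > 0`,
`#{0 < γ′ < T : (β′ − ½) log γ′ ≤ ν} ≥ e^{−C(ν)} T log T` for all large `T`. A PREDICATE in `C`,
never asserted. [cite: FarmerKi2012, §1 Theorem 1.3 (1.5)] -/
def Hypothesis15 (C : ℝ → ℝ) : Prop :=
  (∀ ν : ℝ, 0 < ν → 0 < C ν) ∧
    Tendsto (fun ν => Real.sqrt ν * C ν) (𝓝[>] 0) (𝓝 0) ∧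
    Tendsto C (𝓝[>] 0) atTop ∧
    ∀ ν : ℝ, 0 < ν → ∃ T₀ : ℝ, ∀ T : ℝ, T₀ ≤ T →
      Real.exp (-C ν) * T * Real.log T ≤ ((derivZerosNearLine ν T).ncard : ℝ)

end FarmerKi2012

/-- **Farmer–Ki 2012, Theorem 1.3** (NAMED FACT, AS PRINTED): assume RH and (1.5) (with the side
conditions on `C(ν)`); then for every `ν > 0`,
`liminf_{T→∞} #{γ_n ≤ T : (γ_{n+1} − γ_n) log γ_n ≤ ν}/(T log T/log log T) > 0`, i.e. there are
`c > 0`, `T₀` with `#{…} ≥ c · T log T/log log T` for `T ≥ T₀`. Not proved here (§§2–3 of the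
source: Titchmarsh Theorem 9.6(A)/14.20-type input and a convexity argument for `ζ′/ζ`).
[cite: FarmerKi2012, §1 Theorem 1.3] -/
def farmerKi2012_theorem13 : Prop :=
  RiemannHypothesis → ∀ C : ℝ → ℝ, FarmerKi2012.Hypothesis15 C →
    ∀ ν : ℝ, 0 < ν → ∃ c : ℝ, 0 < c ∧ ∃ T₀ : ℝ, ∀ T : ℝ, T₀ ≤ T →
      c * (T * Real.log T / Real.log (Real.log T)) ≤ (FarmerKi2012.smallGapCount ν T : ℝ)

namespace FarmerKi2012

/-- The small-gap count is monotone in the threshold `ν` (for the finite index sets below a height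
where only finitely many ordinates lie; stated for sets known to be finite). [cite: FarmerKi2012, §1 (1.6)] -/
theorem smallGapCount_mono {ν ν' T : ℝ} (hνν : ν ≤ ν')
    (hfin : {n : ℕ | zetaOrdinate n ≤ T ∧
      (zetaOrdinate (n + 1) - zetaOrdinate n) * Real.log (zetaOrdinate n) ≤ ν'}.Finite) :
    smallGapCount ν T ≤ smallGapCount ν' T := by
  unfold smallGapCount
  exact Set.ncard_le_ncard (fun n hn => ⟨hn.1, hn.2.trans hνν⟩) hfin

/-- **Reading** (PROVED modulo the fact): under RH and Farmer–Ki's hypothesis (1.5), for every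
`ν > 0` and every `A`, eventually `#{γ_n ≤ T : (γ_{n+1} − γ_n) log γ_n ≤ ν} ≥ A · T (log T)^{4/5}`
— the count exceeds any multiple of Conrey–Iwaniec's threshold `T(log T)^{4/5}`, because
`log log T = o((log T)^{1/5})`. [cite: FarmerKi2012, §1 Theorem 1.3 and the paragraph after it]
[cite: ConreyIwaniec2002, Theorem 1.2 (1.22)] -/
theorem many_small_gaps (h : farmerKi2012_theorem13) (hRH : RiemannHypothesis) {C : ℝ → ℝ}
    (hC : Hypothesis15 C) {ν : ℝ} (hν : 0 < ν) {A : ℝ} (hA : 0 < A) :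
    ∃ T₁ : ℝ, ∀ T : ℝ, T₁ ≤ T →
      A * (T * Real.log T ^ ((4 : ℝ) / 5)) ≤ (smallGapCount ν T : ℝ) := by
  obtain ⟨c, hc, T₀, hT₀⟩ := h hRH C hC ν hν
  -- `log u ≤ (c/A) u^{1/5}` for large `u`, applied at `u = log T`
  have hsmall : ∀ᶠ u : ℝ in atTop, ‖Real.log u‖ ≤ (c / A) * ‖u ^ ((1 : ℝ) / 5)‖ :=
    (isLittleO_log_rpow_atTop (by norm_num : (0 : ℝ) < 1 / 5)).def (by positivity)
  have hev : ∀ᶠ T : ℝ in atTop,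
      ‖Real.log (Real.log T)‖ ≤ (c / A) * ‖Real.log T ^ ((1 : ℝ) / 5)‖ ∧ 1 < Real.log (Real.log T) :=
    (Real.tendsto_log_atTop.eventually hsmall).and
      ((Real.tendsto_log_atTop.comp Real.tendsto_log_atTop).eventually (eventually_gt_atTop 1))
  obtain ⟨T₂, hT₂⟩ := eventually_atTop.mp hev
  refine ⟨max T₀ (max T₂ 3), fun T hT => ?_⟩
  have hT0 : T₀ ≤ T := le_trans (le_max_left _ _) hT
  have hT2 : T₂ ≤ T := le_trans (le_trans (le_max_left _ _) (le_max_right _ _)) hT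
  have hT3 : 3 ≤ T := le_trans (le_trans (le_max_right _ _) (le_max_right _ _)) hT
  obtain ⟨hlog, hll1⟩ := hT₂ T hT2
  have hTpos : 0 < T := by linarith
  have hlogT : 0 < Real.log T := Real.log_pos (by linarith)
  have hll0 : 0 < Real.log (Real.log T) := by linarith
  have hpow0 : 0 < Real.log T ^ ((1 : ℝ) / 5) := Real.rpow_pos_of_pos hlogT _
  rw [Real.norm_of_nonneg hll0.le, Real.norm_of_nonneg hpow0.le] at hlog
  -- `A T (log T)^{4/5} ≤ c T log T / log log T`
  have hmul : Real.log T ^ ((1 : ℝ) / 5) * Real.log T ^ ((4 : ℝ) / 5) = Real.log T := by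
    rw [← Real.rpow_add hlogT]; norm_num
  have h1 : A * Real.log (Real.log T) ≤ c * Real.log T ^ ((1 : ℝ) / 5) := by
    have := mul_le_mul_of_nonneg_left hlog hA.le
    calc A * Real.log (Real.log T) ≤ A * (c / A * Real.log T ^ ((1 : ℝ) / 5)) := this
      _ = c * Real.log T ^ ((1 : ℝ) / 5) := by field_simp
  have h2 : 0 ≤ T * Real.log T ^ ((4 : ℝ) / 5) := by positivity
  have key : A * (T * Real.log T ^ ((4 : ℝ) / 5)) ≤ c * (T * Real.log T / Real.log (Real.log T)) := by
    rw [mul_div_assoc', le_div_iff₀ hll0]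
    calc A * (T * Real.log T ^ ((4 : ℝ) / 5)) * Real.log (Real.log T)
        = (A * Real.log (Real.log T)) * (T * Real.log T ^ ((4 : ℝ) / 5)) := by ring
      _ ≤ (c * Real.log T ^ ((1 : ℝ) / 5)) * (T * Real.log T ^ ((4 : ℝ) / 5)) :=
          mul_le_mul_of_nonneg_right h1 h2
      _ = c * (T * (Real.log T ^ ((1 : ℝ) / 5) * Real.log T ^ ((4 : ℝ) / 5))) := by ring
      _ = c * (T * Real.log T) := by rw [hmul]
  exact key.trans (hT₀ T hT0)

end FarmerKi2012

end Literature.NumberTheory.LFunctions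

end
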